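import Literature.AlgebraicGeometry.Resolution.FormalFibresRegularProofs
import Literature.AlgebraicGeometry.Resolution.PowerSeriesRegularLocal
import Literature.AlgebraicGeometry.Resolution.AdicCompletionSemilocal
import Literature.AlgebraicGeometry.Resolution.GRingAdicCompletionRegularHom
import Literature.AlgebraicGeometry.Resolution.ExcellentRingsEssFiniteType
import Literature.AlgebraicGeometry.Resolution.ExcellentRingsFieldProofs
import Literature.AlgebraicGeometry.Resolution.RegularHomComposition
import Literature.AlgebraicGeometry.Resolution.RegularHomLocalization
import Literature.AlgebraicGeometry.Resolution.AdicNoetherian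
import HarnessLib

/-!
# Crux `PatchingRelPerfect` (stmt-ResolutionOfSingularities-16161), chain W5.2 — F7(β) (β-AX) T0 `InitialMultiHost₂`,
# piece (B-alg) CORE A: the Cohen coordinate map `κ₀[X₁, …, X_d] → S` of a complete regular local ring with a
# coefficient field is a REGULAR HOMOMORPHISM

[OURS · L1 W5.2 · rung tool; res-L1-w52-plan-1 RULING G11-27 (2) → res-D-pv-046 (B-alg `DepthMultiHost.DirectionMapRegular`,
core A of the PACE 17:27Z)] Replaces the role of NO printed item of the manuscript under review; fact-free; any
dimension, any characteristic.

Let `(S, 𝔪)` be a complete regular local ring of dimension `d`, `σ : κ₀ → S` a coefficient field (a ring map from a field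
whose composite with the residue map is bijective) and `x₁, …, x_d` a regular system of parameters. The substitution map
`κ₀[X₁, …, X_d] → S`, `Xᵢ ↦ xᵢ`, constants through `σ`, is a regular homomorphism (flat with geometrically regular
fibres). Proof: it is the composite `κ₀[X] → κ₀[X]_{(X)} → (κ₀[X]_{(X)})^ ≅ κ₀⟦X⟧ ≅ S` of a localisation
(`isRegularHom_of_isLocalization`), the completion of the excellent local ring `κ₀[X]_{(X)}`
(`isRegularHom_adicCompletion_of_isQuasiExcellentRing`), the tree's identification `mvPowerSeriesEquivAdicCompletionOrigin`
and Cohen's expansion isomorphism `κ₀⟦X⟧ ≅ S` (`comp_map_bijective`, Matsumura Thm. 29.7); the two isomorphisms are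
compatible with the maps from `κ₀[X]` (`adicCompletionEquivOfLE_of`, `adicCompletionAtMaximalEquiv_of`,
`MvPowerSeries.toAdicCompletion_coe`; `exists_adicEvalHom` (1)), so `IsRegularHom.comp` / `IsRegularHom.of_algEquiv`
conclude.

* `isRegularHom_cohenCoordinates` — the statement above.

## References (for the mathematics; nothing here is a statement of the manuscript under review)
* H. Matsumura, *Commutative Ring Theory* (1986), Thm. 28.3, Thm. 29.7, §32 p. 260. [Matsumura1987]
* A. Grothendieck, EGA IV₂ (7.8.3) (v). [EGAIV2]
-/

-- `Summit.<Summit>.<Sub>.Theorems` with `Sub = Summit` (single-conjunct summit, D-0017)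
set_option linter.dupNamespace false

noncomputable section

open IsLocalRing AdicCompletion Literature.AlgebraicGeometry.Resolution

namespace Summit.ResolutionOfSingularities.ResolutionOfSingularities.Theorems

universe u

namespace DepthMultiHost

variable {κ₀ : Type u} [Field κ₀]

/-- Bookkeeping: `MvPowerSeries.map` along a ring isomorphism is bijective. [folklore] -/
theorem mvPowerSeries_map_bijective_of_ringEquiv {K : Type u} [CommRing K] {τ : Type*} (ι : κ₀ ≃+* K) :
    Function.Bijective (MvPowerSeries.map (σ := τ) (ι : κ₀ →+* K)) := by
  refine Function.bijective_iff_has_inverse.mpr ⟨MvPowerSeries.map (σ := τ) (ι.symm : K →+* κ₀), ?_, ?_⟩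
  · intro f
    ext e
    simp
  · intro f
    ext e
    simp

/-- Bookkeeping (the tree's private `originEquiv_symm_of` of `Hironaka2017/…/GCleanChartAffineWitness`, re-proved): the
identification `κ₀⟦X⟧ ≃ (κ₀[X]_{(X)})^` inverted sends the image of a polynomial to the polynomial read as a power
series. [cite: Matsumura1987, Thm. 8.15 (proof)] -/
theorem mvPowerSeriesEquivAdicCompletionOrigin_symm_algebraMap (d : ℕ) (q : MvPolynomial (Fin d) κ₀) :
    (mvPowerSeriesEquivAdicCompletionOrigin κ₀ d).symm
        (algebraMap (MvPolynomial (Fin d) κ₀)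
          (AdicCompletion (maximalIdeal (OriginLocalization κ₀ d)) (OriginLocalization κ₀ d)) q) =
      (q : MvPowerSeries (Fin d) κ₀) := by
  rw [RingEquiv.symm_apply_eq, AdicCompletion.algebraMap_apply]
  have hI : MvPolynomial.idealOfVars (Fin d) κ₀ = originIdeal κ₀ d := (originIdeal_eq_span κ₀ d).symm
  have h1 : mvPowerSeriesEquivAdicCompletionOrigin κ₀ d (q : MvPowerSeries (Fin d) κ₀) =
      adicCompletionAtMaximalEquiv (originIdeal κ₀ d)
        (adicCompletionEquivOfLE (MvPolynomial.idealOfVars (Fin d) κ₀) (originIdeal κ₀ d) (e := 1)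
          (by rw [pow_one, hI]) hI.le
          (MvPowerSeries.toAdicCompletionAlgEquiv (Fin d) κ₀ (q : MvPowerSeries (Fin d) κ₀))) := rfl
  rw [h1, MvPowerSeries.toAdicCompletionAlgEquiv_apply, MvPowerSeries.toAdicCompletion_coe,
    adicCompletionEquivOfLE_of, adicCompletionAtMaximalEquiv_of]

/-- **The Cohen coordinate map of a complete regular local ring with a coefficient field is a regular homomorphism.**
For `S` complete regular local of dimension `d`, `σ : κ₀ →+* S` with `κ₀ → S → S/𝔪` bijective, and a regular system of
parameters `x : Fin d → S`, the substitution homomorphism `MvPolynomial.eval₂Hom σ x : κ₀[X₁,…,X_d] → S` is flat with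
geometrically regular fibres. [cite: Matsumura1987, Thm. 29.7 with §32 p. 260] -/
theorem isRegularHom_cohenCoordinates {S : Type u} [CommRing S] [IsRegularLocalRing S]
    [IsAdicComplete (maximalIdeal S) S] (σ : κ₀ →+* S) (hσ : Function.Bijective ((residue S).comp σ))
    {d : ℕ} (x : Fin d → S) (hx : Ideal.span (Set.range x) = maximalIdeal S) (hd : ringKrullDim S = d) :
    letI := (MvPolynomial.eval₂Hom σ x).toAlgebra
    IsRegularHom (MvPolynomial (Fin d) κ₀) S := by
  classical
  letI algS := (MvPolynomial.eval₂Hom σ x).toAlgebra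
  -- notation
  set R := MvPolynomial (Fin d) κ₀ with hR
  set T := OriginLocalization κ₀ d with hT
  set A := AdicCompletion (maximalIdeal T) T with hA
  haveI : IsNoetherianRing A := isNoetherianRing_adicCompletion_maximalIdeal T
  /- (1) `R → T → Â` is a regular homomorphism -/
  have hRT : IsRegularHom R T := isRegularHom_of_isLocalization (originIdeal κ₀ d).primeCompl
  have hTexc : IsExcellentRing T :=
    isExcellentRing_localization_atPrime (isExcellentRing_of_field κ₀) (B := R) (originIdeal κ₀ d)
  have hTA : IsRegularHom T A :=
    isRegularHom_adicCompletion_of_isQuasiExcellentRing (maximalIdeal T) hTexc.isQuasiExcellentRing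
  have hRA : IsRegularHom R A := hRT.comp hTA
  /- (2) Cohen: `κ₀⟦X⟧ ≃ S`, `Xᵢ ↦ xᵢ`, constants through `σ` -/
  let ι : κ₀ ≃+* ResidueField S := RingEquiv.ofBijective ((residue S).comp σ) hσ
  let σ' : ResidueField S →+* S := σ.comp (ι.symm : ResidueField S →+* κ₀)
  have hσ' : ∀ c, residue S (σ' c) = c := fun c => by
    change ((residue S).comp σ) (ι.symm c) = c
    exact ι.apply_symm_apply c
  have hσ'ι : σ'.comp (ι : κ₀ →+* ResidueField S) = σ := by
    ext c
    change σ (ι.symm (ι c)) = σ c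
    rw [ι.symm_apply_apply]
  have hd' : (maximalIdeal S).spanFinrank = d := by
    have h := IsRegularLocalRing.spanFinrank_maximalIdeal (R := S)
    rw [hd] at h
    exact_mod_cast h
  have hxm : ∀ i, x i ∈ maximalIdeal S := fun i => hx ▸ Ideal.subset_span ⟨i, rfl⟩
  obtain ⟨Φ, hΦ₁, hΦ₂⟩ := exists_adicEvalHom (maximalIdeal S) x hxm
  have hbij : Function.Bijective (Φ.comp (MvPowerSeries.map (σ := Fin d) σ)) := by
    rw [← hσ'ι, MvPowerSeries.map_comp, ← RingHom.comp_assoc]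
    exact (comp_map_bijective σ' hσ' hd' x hx Φ hΦ₁ hΦ₂).comp (mvPowerSeries_map_bijective_of_ringEquiv ι)
  let Ψ₁ : MvPowerSeries (Fin d) κ₀ ≃+* S := RingEquiv.ofBijective _ hbij
  have hΨ₁ : ∀ q : R, Ψ₁ (q : MvPowerSeries (Fin d) κ₀) = MvPolynomial.eval₂Hom σ x q := by
    intro q
    change Φ (MvPowerSeries.map σ (q : MvPowerSeries (Fin d) κ₀)) = _
    rw [← coe_mvPolynomial_map, hΦ₁, MvPolynomial.eval_map, MvPolynomial.coe_eval₂Hom]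
  /- (3) `Â ≃ S` over `R` -/
  let Ψ : A ≃+* S := (mvPowerSeriesEquivAdicCompletionOrigin κ₀ d).symm.trans Ψ₁
  have hΨ : ∀ q : R, Ψ (algebraMap R A q) = algebraMap R S q := by
    intro q
    change Ψ₁ ((mvPowerSeriesEquivAdicCompletionOrigin κ₀ d).symm (algebraMap R A q)) = MvPolynomial.eval₂Hom σ x q
    rw [mvPowerSeriesEquivAdicCompletionOrigin_symm_algebraMap, hΨ₁]
  let e : A ≃ₐ[R] S := AlgEquiv.ofRingEquiv (f := Ψ) hΨ
  exact hRA.of_algEquiv e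

end DepthMultiHost

end Summit.ResolutionOfSingularities.ResolutionOfSingularities.Theorems

end
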